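import Summits.RiemannHypothesis.RiemannHypothesis.Theorems.ConnesConsaniSemilocalWindowSpectralBoundOfSection6
import Literature.NumberTheory.ConnesConsani2021.ArchKernelTier2Final
import HarnessLib

/-!
# Route «ConnesConsaniSemilocal», crux K3 `WindowSpectralBound` (stmt-RiemannHypothesis-19306) — CLOSER

RH-FREE corpus statement, closed UNCONDITIONALLY: the named fact `CC2021_section6_enclosures` is a tree theorem
(`CC2021_section6_enclosures_holds`, in-kernel (E-a) Tier-2 certificate, `ArchKernelTier2Final`) and the landed K3 transport
`CCRouteAdapters.windowSpectralBound_of_section6` (sos-filer-1) carries it to the route decl.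
WHAT THIS IS NOT: any claim about RH — K3 is an RH-FREE binder of an RH-FREE leaf (FRONTIER rung W-C(C1), zero summit credit);
nothing here bears on the truth of RH.
-/

set_option linter.dupNamespace false

namespace Summit.RiemannHypothesis.RiemannHypothesis.Theorems.ConnesConsaniSemilocalWindowSpectralBound

open Literature.NumberTheory.ConnesConsani2021

/-- RH-FREE. **K3 `WindowSpectralBound` HOLDS**: for every C² archimedean density `G` with the prolate expansion there is
`a₀ ∈ [0, 0.0635]` with `⟨ξ, ξ − 𝒲ξ⟩ + a₀ |⟨1, ξ⟩|² ≥ 0` on `L²([−log 2/2, log 2/2])` — the (E-a) certificate + the K3 transport;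
the type is literally the route decl. -/
theorem windowSpectralBound_proof :
    Summit.RiemannHypothesis.RiemannHypothesis.Theses.ConnesConsaniSemilocal.WindowSpectralBound :=
  CCRouteAdapters.windowSpectralBound_of_section6 CC2021_section6_enclosures_holds

end Summit.RiemannHypothesis.RiemannHypothesis.Theorems.ConnesConsaniSemilocalWindowSpectralBound
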